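import Summits.AtomisticToContinuum.HydrodynamicLimit.Theorems.CollisionIsometryCLTCollisionalTransferLocalityDefsC
import Summits.AtomisticToContinuum.HydrodynamicLimit.Theorems.CollisionIsometryCLTCollisionalTransferLocalityAffineSlaving
import HarnessLib

/-!
# Audit lemmas for the v10 reshape of the line `hemisphere-affine-slaving`: the marked virial [M]
versus v9's [A'-chaos] ∧ [B-dyn] (crux `CollisionalTransferLocality`, stmt-AtomisticToContinuum-9518)

Version 9 of the skeleton of the line had two research stubs at one `(σ, profiles, Φ, kernel, t, ψ, χ)`:
[A'-chaos] `FluxFormChaos` (`sup_{τ ≤ t} |M_N − Sraw_N| → 0` in local-Gibbs probability) and [B-dyn]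
`ContactVirial … p` (`sup_{τ ≤ t} |S_N − (RhsG p + KfunG p)| → 0`). Version 10 replaces both by ONE
stub [M], the MARKED VIRIAL: `sup_{τ ≤ t} |M_N − (RhsG p + KfunG p)| → 0`. This file is the
kernel-checked certificate that v10 asks LESS than v9 (and, given [B-dyn], the same):

* `markedVirial_of_fluxFormChaos_of_contactVirial` — [A'-chaos] ∧ [B-dyn] ⟹ [M] at one
  `(σ, profiles, Φ, kernel, t, ψ, χ, p)`;
* `fluxFormChaos_of_markedVirial_of_contactVirial` — [M] ∧ [B-dyn] ⟹ [A'-chaos] (converse);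
* `markedVirialE_of_fluxFormChaosE_of_contactVirialE` — the fully quantified form: v9's
  `stub_fluxFormChaosE` statement and v9's `stub_contactVirialE` statement imply v10's
  `stub_markedVirialE` statement (quantifier bookkeeping on top of the first lemma, `σ₀ := min σA σB`).

The one mathematical input is the LANDED lever `stub_affineSlaving : AffineSlavingIdentity`, through
`Sraw_eq_Sfun`: for a nonnegative kernel and a test `ψ` with smooth slices on `(0, τ]` the raw and the
slaved collision sums agree PATHWISE, `Sraw_N(z, τ) = S_N(z, τ)` for every `z` (no good set, no
probability). Then `|M − (RhsG + KfunG)| ≤ |M − Sraw| + |S − (RhsG + KfunG)|` (`abs_sub_le`), the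
sup-`τ` bad event at level `δ` is covered by the two sup-`τ` bad events at level `δ/2`, union bound
(`measure_union_le`) and squeeze in `ℝ≥0∞`. No new definitions, no named facts, nothing assumed.
-/

namespace Summit.AtomisticToContinuum.HydrodynamicLimit.Theorems.HemisphereAffineSlaving

open scoped BigOperators Topology Classical ENNReal InnerProductSpace
open Filter Set Function MeasureTheory

noncomputable section

open Literature.MathematicalPhysics.KineticTheory (T3 V3)

/-- Union bound for two sup-`τ` bad events linked by a pointwise triangle inequality: if for every
`z` and every `τ ∈ [0, t]` one has `|f z τ| ≤ |g z τ| + |h z τ|`, then the event `{∃ τ ≤ t, δ < |f|}`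
has measure at most that of `{∃ τ ≤ t, δ/2 < |g|}` plus that of `{∃ τ ≤ t, δ/2 < |h|}`. -/
private theorem measure_supBad_le_add {N : ℕ} (P : Measure (Cfg N)) {t δ : ℝ}
    {f g h : Cfg N → ℝ → ℝ} (hle : ∀ z, ∀ τ ∈ Icc 0 t, |f z τ| ≤ |g z τ| + |h z τ|) :
    P {z | ∃ τ ∈ Icc 0 t, δ < |f z τ|} ≤
      P {z | ∃ τ ∈ Icc 0 t, δ / 2 < |g z τ|} + P {z | ∃ τ ∈ Icc 0 t, δ / 2 < |h z τ|} := by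
  have hcover : {z : Cfg N | ∃ τ ∈ Icc 0 t, δ < |f z τ|} ⊆
      {z | ∃ τ ∈ Icc 0 t, δ / 2 < |g z τ|} ∪ {z | ∃ τ ∈ Icc 0 t, δ / 2 < |h z τ|} := by
    rintro z ⟨τ, hτ, hzδ⟩
    by_contra hno
    simp only [Set.mem_union, Set.mem_setOf_eq, not_or, not_exists, not_and, not_lt] at hno
    have e₁ := hno.1 τ hτ
    have e₂ := hno.2 τ hτ
    have h₃ := hle z τ hτ
    linarith
  exact (measure_mono hcover).trans (measure_union_le _ _)

/-- **Registered helper `markedVirial_of_fluxFormChaos_of_contactVirial` — v10 asks less than v9.**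
At one `(σ, profiles, Φ, kernel, t, ψ, χ)` and one pressure function `p`: [A'-chaos]
`FluxFormChaos σ a₀ θ₀ u₀ Φ φ t ψ χ` (`sup_τ |M_N − Sraw_N| → 0` in local-Gibbs probability) and [B-dyn]
`ContactVirial σ a₀ θ₀ u₀ Φ φ t ψ χ p` (`sup_τ |S_N − (RhsG p + KfunG p)| → 0`) imply the marked virial
[M]: `sup_τ |M_N − (RhsG p + KfunG p)| → 0`. The kernel is nonnegative (`AdmissibleKernel`) and `ψ` has
smooth slices on `[0, t]`, so `Sraw_N = S_N` pathwise by the landed lever (`Sraw_eq_Sfun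
stub_affineSlaving`); triangle inequality at level `δ/2`, union bound, squeeze. [folklore] -/
theorem markedVirial_of_fluxFormChaos_of_contactVirial : ∀ {σ : ℝ} {a₀ θ₀ : T3 → ℝ} {u₀ : T3 → V3} {Φ : Flows σ} {γ C : ℝ} {φ : ℕ → T3 → ℝ}, AdmissibleKernel γ C φ → ∀ {t : ℝ} {ψ : ℝ → T3 → V3} {χ : ℝ → T3 → ℝ}, Literature.Analysis.FunctionSpaces.Torus.IsSmoothSpaceTimeOn (Icc 0 t) ψ → ∀ (p : ℝ → ℝ → ℝ), FluxFormChaos σ a₀ θ₀ u₀ Φ φ t ψ χ → ContactVirial σ a₀ θ₀ u₀ Φ φ t ψ χ p → ∀ δ : ℝ, 0 < δ → Tendsto (fun N : ℕ => Literature.MathematicalPhysics.KineticTheory.localGibbsLaw σ a₀ u₀ θ₀ N (Φ N) {z | ∃ τ ∈ Icc 0 t, δ < |Mfun σ Φ ψ χ N z τ - (RhsG σ Φ φ ψ χ p N z τ + KfunG σ Φ φ ψ χ p N z τ)|}) atTop (𝓝 0) := by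
  intro σ a₀ θ₀ u₀ Φ γ C φ hadm t ψ χ hψ p hA hB δ hδ
  have hδ2 : 0 < δ / 2 := half_pos hδ
  have hsum := (hA (δ / 2) hδ2).add (hB (δ / 2) hδ2)
  rw [add_zero] at hsum
  refine tendsto_of_tendsto_of_tendsto_of_le_of_le tendsto_const_nhds hsum (fun N => bot_le) fun N => ?_
  refine measure_supBad_le_add _ fun z τ hτ => ?_
  have h2 : Sraw σ Φ φ ψ χ N z τ = Sfun σ Φ φ ψ χ N z τ :=
    Sraw_eq_Sfun stub_affineSlaving σ Φ φ ψ χ N (hadm.2.1 N) z τ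
      (fun s hs => hψ.isSmooth_slice ⟨hs.1.le, hs.2.trans hτ.2⟩)
  rw [h2]
  exact abs_sub_le _ _ _

/-- **Registered helper `fluxFormChaos_of_markedVirial_of_contactVirial` — the converse.** At one
`(σ, profiles, Φ, kernel, t, ψ, χ)` and one pressure function `p`: the marked virial [M]
(`sup_τ |M_N − (RhsG p + KfunG p)| → 0` in local-Gibbs probability) and [B-dyn]
`ContactVirial σ a₀ θ₀ u₀ Φ φ t ψ χ p` imply [A'-chaos] `FluxFormChaos σ a₀ θ₀ u₀ Φ φ t ψ χ`
(`Sraw_N = S_N` pathwise by the landed lever, `|M − Sraw| ≤ |M − (RhsG + KfunG)| + |S − (RhsG + KfunG)|`,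
union bound at level `δ/2`, squeeze). So, GIVEN [B-dyn], v10's [M] and v9's [A'-chaos] are
equivalent. [folklore] -/
theorem fluxFormChaos_of_markedVirial_of_contactVirial : ∀ {σ : ℝ} {a₀ θ₀ : T3 → ℝ} {u₀ : T3 → V3} {Φ : Flows σ} {γ C : ℝ} {φ : ℕ → T3 → ℝ}, AdmissibleKernel γ C φ → ∀ {t : ℝ} {ψ : ℝ → T3 → V3} {χ : ℝ → T3 → ℝ}, Literature.Analysis.FunctionSpaces.Torus.IsSmoothSpaceTimeOn (Icc 0 t) ψ → ∀ (p : ℝ → ℝ → ℝ), (∀ δ : ℝ, 0 < δ → Tendsto (fun N : ℕ => Literature.MathematicalPhysics.KineticTheory.localGibbsLaw σ a₀ u₀ θ₀ N (Φ N) {z | ∃ τ ∈ Icc 0 t, δ < |Mfun σ Φ ψ χ N z τ - (RhsG σ Φ φ ψ χ p N z τ + KfunG σ Φ φ ψ χ p N z τ)|}) atTop (𝓝 0)) → ContactVirial σ a₀ θ₀ u₀ Φ φ t ψ χ p → FluxFormChaos σ a₀ θ₀ u₀ Φ φ t ψ χ := by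
  intro σ a₀ θ₀ u₀ Φ γ C φ hadm t ψ χ hψ p hM hB δ hδ
  have hδ2 : 0 < δ / 2 := half_pos hδ
  have hsum := (hM (δ / 2) hδ2).add (hB (δ / 2) hδ2)
  rw [add_zero] at hsum
  refine tendsto_of_tendsto_of_tendsto_of_le_of_le tendsto_const_nhds hsum (fun N => bot_le) fun N => ?_
  refine measure_supBad_le_add _ fun z τ hτ => ?_
  have h2 : Sraw σ Φ φ ψ χ N z τ = Sfun σ Φ φ ψ χ N z τ :=
    Sraw_eq_Sfun stub_affineSlaving σ Φ φ ψ χ N (hadm.2.1 N) z τ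
      (fun s hs => hψ.isSmooth_slice ⟨hs.1.le, hs.2.trans hτ.2⟩)
  rw [h2, abs_sub_comm (Sfun σ Φ φ ψ χ N z τ)]
  exact abs_sub_le _ _ _

/-- **Registered helper `markedVirialE_of_fluxFormChaosE_of_contactVirialE` — the weakening
certificate of the v10 reshape, fully quantified.** The v9 statement of `stub_fluxFormChaosE`
([A'-chaos] for all small `σ`, all flows with energy ceiling and virial bound, all admissible dilute
kernels and all smooth test pairs) together with the v9 statement of `stub_contactVirialE` ([B-dyn] at
the pressure `pOf Y σ` of a static value function `Y`, same quantifier prefix after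
`Y, η₀, StaticShell Y η₀, η₁ < η₀`) implies the v10 statement of `stub_markedVirialE` ([M] at `pOf Y σ`,
same prefix): take `σ₀ := min σA σB` of the two thresholds and apply
`markedVirial_of_fluxFormChaos_of_contactVirial` pointwise in the remaining quantifiers. Both v9
statements enter as HYPOTHESES (they are open research stubs; nothing is assumed). [folklore] -/
theorem markedVirialE_of_fluxFormChaosE_of_contactVirialE : (∀ η₁ : ℝ, 0 < η₁ → ∀ (a₀ θ₀ : T3 → ℝ) (u₀ : T3 → V3), NiceProfiles a₀ θ₀ u₀ → ∃ σ₀ : ℝ, 0 < σ₀ ∧ ∀ σ : ℝ, 0 < σ → σ < σ₀ → ∀ (Φ : Flows σ) (t E₀ : ℝ), 0 < t → Tendsto (fun N : ℕ => Literature.MathematicalPhysics.KineticTheory.localGibbsLaw σ a₀ u₀ θ₀ N (Φ N) {z | ∃ s ∈ Icc 0 t, E₀ < ((N : ℝ) + 1)⁻¹ * Literature.Analysis.FluidPDE.configEnergy ((Φ N).flow s z)}) atTop (𝓝 0) → VirialBounded σ a₀ θ₀ u₀ Φ t → ∀ (γ C : ℝ) (φ : ℕ → T3 → ℝ), 0 <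 γ → γ ≤ 1 / 15 → AdmissibleKernel γ C φ → DiluteAt σ a₀ θ₀ u₀ Φ t φ η₁ → ∀ (ψ : ℝ → T3 → V3) (χ : ℝ → T3 → ℝ), Literature.Analysis.FunctionSpaces.Torus.IsSmoothSpaceTimeOn (Icc 0 t) ψ → Literature.Analysis.FunctionSpaces.Torus.IsSmoothSpaceTimeOn (Icc 0 t) χ → FluxFormChaos σ a₀ θ₀ u₀ Φ φ t ψ χ) → (∀ (Y : ℝ → ℝ) (η₀ : ℝ), 0 < η₀ → StaticShell Y η₀ → ∀ η₁ : ℝ, 0 < η₁ → η₁ < η₀ → ∀ (a₀ θ₀ : T3 → ℝ) (u₀ : T3 → V3), NiceProfiles a₀ θ₀ u₀ → ∃ σ₀ : ℝ, 0 < σ₀ ∧ ∀ σ : ℝ, 0 < σ → σ < σ₀ → ∀ (Φ : Flows σ) (t E₀ : ℝ), 0 < t → Tendsto (fun N : ℕ => Literature.MathematicalPhysics.KineticTheory.localGibbsLaw σ a₀ u₀ θ₀ N (Φ N) {z | ∃ s ∈ Icc 0 t, E₀ < ((N : ℝ) + 1)⁻¹ * Literature.Analysis.FluidPDE.configEnergy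 ((Φ N).flow s z)}) atTop (𝓝 0) → VirialBounded σ a₀ θ₀ u₀ Φ t → ∀ (γ C : ℝ) (φ : ℕ → T3 → ℝ), 0 < γ → γ ≤ 1 / 15 → AdmissibleKernel γ C φ → DiluteAt σ a₀ θ₀ u₀ Φ t φ η₁ → ∀ (ψ : ℝ → T3 → V3) (χ : ℝ → T3 → ℝ), Literature.Analysis.FunctionSpaces.Torus.IsSmoothSpaceTimeOn (Icc 0 t) ψ → Literature.Analysis.FunctionSpaces.Torus.IsSmoothSpaceTimeOn (Icc 0 t) χ → ContactVirial σ a₀ θ₀ u₀ Φ φ t ψ χ (pOf Y σ)) → ∀ (Y : ℝ → ℝ) (η₀ : ℝ), 0 < η₀ → StaticShell Y η₀ → ∀ η₁ : ℝ, 0 < η₁ → η₁ < η₀ → ∀ (a₀ θ₀ : T3 → ℝ) (u₀ : T3 → V3), NiceProfiles a₀ θ₀ u₀ → ∃ σ₀ : ℝ, 0 < σ₀ ∧ ∀ σ : ℝ, 0 < σ → σ < σ₀ → ∀ (Φ : Flows σ) (t E₀ : ℝ), 0 < t → Tendsto (fun N : ℕ => Literature.MathematicalPhysics.KineticTheory.localGibbsLaw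 σ a₀ u₀ θ₀ N (Φ N) {z | ∃ s ∈ Icc 0 t, E₀ < ((N : ℝ) + 1)⁻¹ * Literature.Analysis.FluidPDE.configEnergy ((Φ N).flow s z)}) atTop (𝓝 0) → VirialBounded σ a₀ θ₀ u₀ Φ t → ∀ (γ C : ℝ) (φ : ℕ → T3 → ℝ), 0 < γ → γ ≤ 1 / 15 → AdmissibleKernel γ C φ → DiluteAt σ a₀ θ₀ u₀ Φ t φ η₁ → ∀ (ψ : ℝ → T3 → V3) (χ : ℝ → T3 → ℝ), Literature.Analysis.FunctionSpaces.Torus.IsSmoothSpaceTimeOn (Icc 0 t) ψ → Literature.Analysis.FunctionSpaces.Torus.IsSmoothSpaceTimeOn (Icc 0 t) χ → ∀ δ : ℝ, 0 < δ → Tendsto (fun N : ℕ => Literature.MathematicalPhysics.KineticTheory.localGibbsLaw σ a₀ u₀ θ₀ N (Φ N) {z | ∃ τ ∈ Icc 0 t, δ < |Mfun σ Φ ψ χ N z τ - (RhsG σ Φ φ ψ χ (pOf Y σ) N z τ + KfunG σ Φ φ ψ χ (pOf Y σ) N z τ)|}) atTop (𝓝 0) := by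
  intro HA HB Y η₀ hη₀ hSh η₁ hη₁ hη₁' a₀ θ₀ u₀ hP
  obtain ⟨σA, hσA, HA'⟩ := HA η₁ hη₁ a₀ θ₀ u₀ hP
  obtain ⟨σB, hσB, HB'⟩ := HB Y η₀ hη₀ hSh η₁ hη₁ hη₁' a₀ θ₀ u₀ hP
  refine ⟨min σA σB, lt_min hσA hσB, ?_⟩
  intro σ hσ hσlt Φ t E₀ ht hE hV γ C φ hγ hγ' hadm hDil ψ χ hψ hχ
  have hFA : FluxFormChaos σ a₀ θ₀ u₀ Φ φ t ψ χ :=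
    HA' σ hσ (hσlt.trans_le (min_le_left _ _)) Φ t E₀ ht hE hV γ C φ hγ hγ' hadm hDil ψ χ hψ hχ
  have hCB : ContactVirial σ a₀ θ₀ u₀ Φ φ t ψ χ (pOf Y σ) :=
    HB' σ hσ (hσlt.trans_le (min_le_right _ _)) Φ t E₀ ht hE hV γ C φ hγ hγ' hadm hDil ψ χ hψ hχ
  exact markedVirial_of_fluxFormChaos_of_contactVirial hadm hψ (pOf Y σ) hFA hCB

end

end Summit.AtomisticToContinuum.HydrodynamicLimit.Theorems.HemisphereAffineSlaving
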